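import Summits.QuantumFields.BalabanUV.Beta.EriceFlowEnclosureBareSums
import Literature.MathematicalPhysics.QuantumFieldTheory.BalabanJaffe1986.BJ86CouplingRenormalization

/-!
# Beta / EriceFlowEnclosureBareTwoLoopRate — (3.76): the two-loop LOG-RATE (R2-F15 (iii)) is LOAD-BEARING;
# (3.75)'s «β_{n,2} → β₂» does not replace it, even with the one-loop DRIFT and an n-uniform (3.73).
# PART 1 of 2: the witness and its runs (β-flow team, prover 2 = lower-bound ∕ positivity side, unit
# `b2b-balaban-beta-bflow-p2`, gen 4; file 5a, sibling of `EriceFlowEnclosureBareAsymptotics` ∕ `…Sharp`; the kernel form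
# of the paper witness named in fit-ref2's R2-F15 (iii); part 2 = `EriceFlowEnclosureBareTwoLoopRateFails`)

HONEST FRAMING (page 1 of everything the β sub-cell writes): discharging `BetaPertH` makes Bałaban's UV stability
UNCONDITIONAL — a real constructive-QFT result; it is NOT the continuum limit and NOT the Clay problem.  HONEST DEPENDENCY
(cell reorg 2026-08-19, verbatim): «continuum YM on T⁴ ⇐ BetaPertH ∧ nine spine estimates (0/9 proved); BetaPertH ⇐ (D1) ∧
(D4) ∧ CAP+tail; G-an2-4 gates asym, D1 and NE2/3/4.»  THIS MODULE DISCHARGES NOTHING: an explicit toy family (two `def`s,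
no Bałaban object) and elementary real analysis.  Nothing here bears on Bałaban's `β_{k+1}` of [I] (1.22).

THE NECESSITY COLUMN OF ROW E10 (bflow-p1 `ENCLOSURE-MAP.md` v1.1).  The producers of (3.76) in the tree — prover 1's
`EriceFlowEnclosureBareCoupling.bareCouplingAsymptotics376_of_drift` (p255449) and prover 2's
`EriceFlowEnclosureBareAsymptotics.bareCouplingAsymptotics376_of_runs` ∕ `_of_alongRun369` (p255822) — consume, beyond the
typed records, THREE located inputs (fit-ref2 `beta/CITATION-FIT.md` R2-F15): (i) the n-UNIFORM remainder constant of
(3.73) `TaylorSplit373`; (ii) the one-loop DRIFT `Drift.OneLoopDrift β₀ A β_{·,0}`; (iii) the two-loop log-rate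
`∃ E, ∀ K, Σ_{n<K} |β_{n,2} − β₂|/(K − n) ≤ E`.  Kernel necessity so far: (i) d4-p2 `EriceRemainderEnclosureBareCouplingFails`
(p255124); (ii) prover 1's Theorem B (an implication at small g) and prover 2's toy `…BareAsymptoticsSharp` ((3.75) as printed
⇏ (3.76)); (iii) was a PAPER witness only («(log(n+2))^{−1/2}», R2-F15).  These two files put (iii) in the kernel.

THE WITNESS.  `dip2 n s = −1 + δ_n·s` (exactly quadratic in g: (3.73) holds with remainder constant `C = 0`, n-uniformly —
input (i) at full strength), one-loop coefficients `β_{n,0} = −1` CONSTANT (so the drift (ii) holds with `A = 0` and (3.75)'s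
first clause trivially), two-loop coefficients `β_{n,2} = δ_n := (2√(m+1))⁻¹` on the sparse blocks `16^m ≤ n < 2·16^m`
(`m = Nat.log 16 n`) and `0` elsewhere — so `δ_n → 0 = β₂` ((3.75)'s second clause HOLDS, `tendsto_delta`) while the sums of
(iii) are unbounded (part 2).  Along ANY run of (3.62) for `dip2` ending at `g_K² = 1` with values in `]0,1]`, with
`D(K) := Σ_{j<K} δ_j g_j²`: `1/g₀²(K) = 1 + K − D(K)` (`inv0_eq`), `1 + (K−n)/2 ≤ 1/g_n² ≤ 1 + (K−n)` (`inv_bounds`),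
`0 ≤ D(K) ≤ log K + log(3/2)` (`D_le_log`), `D(16^{m+1}) ≤ 1/7` (`D_start_le`: the blocks below are far away) and
`D(2·16^m) ≥ (m·log 16 − log 2)/(2√(m+1))` (`le_D_block`: the block just consumed; harmonic sum ≥ `log 16^m − log 2` by
`…BareSums.log_sandwich_sum_inv_affine`).  Part 2 concludes: no `β₀′K + β₁·log_L K + O(1)` fits both, for any `β₀′, β₁, L`.
NOT `BetaPertH`, NOT continuum, NOT Clay.
-/

namespace Summit.QuantumFields.BalabanUV.Beta.EriceFlowEnclosureBareTwoLoopRate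

open Filter
open scoped Topology
open Literature.MathematicalPhysics.QuantumFieldTheory.BalabanJaffe1986.BJ86CouplingRenormalization
open Summit.QuantumFields.BalabanUV.Beta.EriceFlowEnclosureBareSums

noncomputable section

/-! ## §1 The witness coefficients -/

/-- The witness two-loop coefficients `δ_n`: amplitude `(2√(m+1))⁻¹` on the sparse ACTIVE blocks `16^m ≤ n < 2·16^m`
(`m = Nat.log 16 n`; the condition `1 ≤ n ∧ n < 2·16^{Nat.log 16 n}` says exactly that), `0` elsewhere.  A toy. -/
def delta (n : ℕ) : ℝ :=
  if 1 ≤ n ∧ n < 2 * 16 ^ Nat.log 16 n then (2 * Real.sqrt ((Nat.log 16 n : ℝ) + 1))⁻¹ else 0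

/-- The witness family `β_n(s) = −1 + δ_n·s` (`s = g²`): one-loop coefficient `−1` at every scale, two-loop coefficient
`δ_n`, no remainder.  A toy, not Bałaban's (1.22). -/
def dip2 (n : ℕ) (s : ℝ) : ℝ := -1 + delta n * s

/-- The amplitude `(2√(m+1))⁻¹` lies in `]0, 1/2]`. -/
theorem amp_pos_le (m : ℕ) :
    0 < (2 * Real.sqrt ((m : ℝ) + 1))⁻¹ ∧ (2 * Real.sqrt ((m : ℝ) + 1))⁻¹ ≤ 1 / 2 := by
  have h1 : (1 : ℝ) ≤ Real.sqrt ((m : ℝ) + 1) :=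
    Real.one_le_sqrt.2 (by have : (0 : ℝ) ≤ m := m.cast_nonneg; linarith)
  refine ⟨by positivity, ?_⟩
  rw [inv_eq_one_div, div_le_div_iff₀ (by positivity) (by norm_num)]
  linarith

/-- `0 ≤ δ_n`. -/
theorem delta_nonneg (n : ℕ) : 0 ≤ delta n := by
  unfold delta
  split_ifs
  · exact (amp_pos_le _).1.le
  · exact le_rfl

/-- `δ_n ≤ 1/2`. -/
theorem delta_le_half (n : ℕ) : delta n ≤ 1 / 2 := by
  unfold delta
  split_ifs
  · exact (amp_pos_le _).2
  · norm_num

/-- `δ_n` is dominated by the vanishing envelope `(2√(Nat.log 16 n + 1))⁻¹`. -/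
theorem delta_le_amp (n : ℕ) : delta n ≤ (2 * Real.sqrt ((Nat.log 16 n : ℝ) + 1))⁻¹ := by
  unfold delta
  split_ifs
  · exact le_rfl
  · exact (amp_pos_le _).1.le

/-- On the block at level `m` (`16^m ≤ n < 2·16^m`) the coefficient is the amplitude `(2√(m+1))⁻¹`. -/
theorem delta_block {m n : ℕ} (h1 : 16 ^ m ≤ n) (h2 : n < 2 * 16 ^ m) :
    delta n = (2 * Real.sqrt ((m : ℝ) + 1))⁻¹ := by
  have hlog : Nat.log 16 n = m :=
    Nat.log_eq_of_pow_le_of_lt_pow h1 (by rw [pow_succ]; omega)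
  have hn1 : 1 ≤ n := le_trans (Nat.one_le_pow _ _ (by norm_num)) h1
  unfold delta
  rw [hlog, if_pos ⟨hn1, h2⟩]

/-- Below level `m+1` (`n < 16^{m+1}`) an ACTIVE scale lies below `2·16^m`: the blocks are far apart. -/
theorem lt_of_active_lt {m n : ℕ} (hn : n < 16 ^ (m + 1)) (hA : 1 ≤ n ∧ n < 2 * 16 ^ Nat.log 16 n) :
    n < 2 * 16 ^ m := by
  have hlog : Nat.log 16 n < m + 1 := Nat.log_lt_of_lt_pow (by omega) hn
  have hle : Nat.log 16 n ≤ m := by omega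
  calc n < 2 * 16 ^ Nat.log 16 n := hA.2
    _ ≤ 2 * 16 ^ m := Nat.mul_le_mul_left 2 (Nat.pow_le_pow_right (by norm_num) hle)

/-- Hence `δ_n = 0` for `2·16^m ≤ n < 16^{m+1}`. -/
theorem delta_eq_zero_below {m n : ℕ} (hn : n < 16 ^ (m + 1)) (h2 : 2 * 16 ^ m ≤ n) : delta n = 0 := by
  unfold delta
  rw [if_neg]
  intro hA
  exact absurd (lt_of_active_lt hn hA) (not_lt.mpr h2)

/-- **(3.75)'s two-loop clause HOLDS for the witness: `δ_n → 0`.** -/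
theorem tendsto_delta : Tendsto delta atTop (𝓝 0) := by
  have hlogNat : Tendsto (fun n : ℕ => Nat.log 16 n) atTop atTop :=
    Monotone.tendsto_atTop_atTop (fun a b h => Nat.log_mono_right h)
      fun m => ⟨16 ^ m, Nat.le_log_of_pow_le (by norm_num) le_rfl⟩
  have hlog : Tendsto (fun n : ℕ => ((Nat.log 16 n : ℕ) : ℝ) + 1) atTop atTop :=
    tendsto_atTop_add_const_right atTop 1 (tendsto_natCast_atTop_atTop.comp hlogNat)
  have hamp : Tendsto (fun n : ℕ => (2 * Real.sqrt ((Nat.log 16 n : ℝ) + 1))⁻¹) atTop (𝓝 0) :=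
    tendsto_inv_atTop_zero.comp
      ((Real.tendsto_sqrt_atTop.comp hlog).const_mul_atTop (by norm_num : (0 : ℝ) < 2))
  exact squeeze_zero (fun n => delta_nonneg n) (fun n => delta_le_amp n) hamp

/-! ## §2 Along one run of (3.62) for `dip2` ending at `g_K² = 1`, values in `]0,1]` -/

section Run

variable {s : ℕ → ℝ} {K : ℕ}

/-- Each consumed two-loop term `δ_j g_j²` lies in `[0, 1/2]`. -/
theorem term_bounds (hs : ∀ n, n ≤ K → 0 < s n ∧ s n ≤ 1) {j : ℕ} (hj : j ≤ K) :
    0 ≤ delta j * s j ∧ delta j * s j ≤ 1 / 2 := by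
  obtain ⟨hp, h1⟩ := hs j hj
  refine ⟨mul_nonneg (delta_nonneg j) hp.le, ?_⟩
  calc delta j * s j ≤ 1 / 2 * 1 := mul_le_mul (delta_le_half j) h1 hp.le (by norm_num)
    _ = 1 / 2 := by ring

/-- (3.70) for the witness: `1/g_n² = 1 + Σ_{j∈[n,K)} (1 − δ_j g_j²)`. -/
theorem inv_eq (h362 : Recursion362 dip2 s K) (hK : s K = 1) {n : ℕ} (hn : n ≤ K) :
    1 / s n = 1 + ∑ j ∈ Finset.Ico n K, (1 - delta j * s j) := by
  have htel := telescope370 h362 hn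
  rw [hK] at htel
  have e : ∑ j ∈ Finset.Ico n K, dip2 j (s j) = ∑ j ∈ Finset.Ico n K, (-(1 - delta j * s j)) :=
    Finset.sum_congr rfl fun j _ => by unfold dip2; ring
  rw [e, Finset.sum_neg_distrib, one_div_one] at htel
  linarith

/-- The run is squeezed: `1 + (K − n)/2 ≤ 1/g_n² ≤ 1 + (K − n)`. -/
theorem inv_bounds (h362 : Recursion362 dip2 s K) (hK : s K = 1) (hs : ∀ n, n ≤ K → 0 < s n ∧ s n ≤ 1)
    {n : ℕ} (hn : n ≤ K) :
    1 + ((K : ℝ) - n) / 2 ≤ 1 / s n ∧ 1 / s n ≤ 1 + ((K : ℝ) - n) := by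
  rw [inv_eq h362 hK hn]
  have hlo : ((K : ℝ) - n) / 2 ≤ ∑ j ∈ Finset.Ico n K, (1 - delta j * s j) := by
    have h := Finset.card_nsmul_le_sum (Finset.Ico n K) (fun j => 1 - delta j * s j) (1 / 2)
      (fun j hj => by have := (term_bounds hs (Finset.mem_Ico.mp hj).2.le).2; linarith)
    rw [Nat.card_Ico, nsmul_eq_mul, Nat.cast_sub hn] at h
    linarith
  have hhi : ∑ j ∈ Finset.Ico n K, (1 - delta j * s j) ≤ ((K : ℝ) - n) := by
    have h := Finset.sum_le_card_nsmul (Finset.Ico n K) (fun j => 1 - delta j * s j) 1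
      (fun j hj => by have := (term_bounds hs (Finset.mem_Ico.mp hj).2.le).1; linarith)
    rw [Nat.card_Ico, nsmul_eq_mul, Nat.cast_sub hn, mul_one] at h
    exact h
  constructor <;> linarith

/-- (3.74) for the witness: the bare end is `1/g₀²(K) = 1 + K − D(K)`, `D(K) = Σ_{j<K} δ_j g_j²`. -/
theorem inv0_eq (h362 : Recursion362 dip2 s K) (hK : s K = 1) :
    1 / s 0 = 1 + K - ∑ j ∈ Finset.range K, delta j * s j := by
  have h := inv_eq h362 hK (Nat.zero_le K)
  rw [← Finset.range_eq_Ico, Finset.sum_sub_distrib, Finset.sum_const, Finset.card_range, nsmul_eq_mul,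
    mul_one] at h
  rw [h]
  ring

/-- Each consumed term is at most `1/(2 + (K − j))`. -/
theorem term_le (h362 : Recursion362 dip2 s K) (hK : s K = 1) (hs : ∀ n, n ≤ K → 0 < s n ∧ s n ≤ 1)
    {j : ℕ} (hj : j < K) : delta j * s j ≤ 1 / (2 + ((K : ℝ) - j)) := by
  obtain ⟨hp, _⟩ := hs j hj.le
  have hlo := (inv_bounds h362 hK hs hj.le).1
  have hKj : (0 : ℝ) ≤ (K : ℝ) - j := by
    have : (j : ℝ) ≤ K := by exact_mod_cast hj.le
    linarith
  have hq : 0 < 2 + ((K : ℝ) - j) := by linarith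
  have h1 : s j * (1 + ((K : ℝ) - j) / 2) ≤ 1 := by
    have := mul_le_mul_of_nonneg_left hlo hp.le
    rwa [mul_one_div_cancel hp.ne'] at this
  rw [le_div_iff₀ hq]
  have hd := delta_le_half j
  have hd0 := delta_nonneg j
  calc delta j * s j * (2 + ((K : ℝ) - j)) = 2 * delta j * (s j * (1 + ((K : ℝ) - j) / 2)) := by ring
    _ ≤ 2 * (1 / 2) * 1 := by
        apply mul_le_mul (by linarith) h1 (by positivity) (by norm_num)
    _ = 1 := by norm_num

/-- `0 ≤ D(K)`. -/
theorem D_nonneg (hs : ∀ n, n ≤ K → 0 < s n ∧ s n ≤ 1) : 0 ≤ ∑ j ∈ Finset.range K, delta j * s j :=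
  Finset.sum_nonneg fun _ hj => (term_bounds hs (Finset.mem_range.mp hj).le).1

/-- `D(K) ≤ log K + log(3/2)` (harmonic comparison, `…BareSums.log_sandwich_sum_inv_affine`). -/
theorem D_le_log (h362 : Recursion362 dip2 s K) (hK : s K = 1) (hs : ∀ n, n ≤ K → 0 < s n ∧ s n ≤ 1) :
    ∑ j ∈ Finset.range K, delta j * s j ≤ Real.log K + Real.log (3 / 2) := by
  calc ∑ j ∈ Finset.range K, delta j * s j ≤ ∑ j ∈ Finset.range K, 1 / (2 + 1 * ((K : ℝ) - j)) :=
        Finset.sum_le_sum fun j hj => by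
          rw [one_mul]; exact term_le h362 hK hs (Finset.mem_range.mp hj)
    _ ≤ (Real.log K + Real.log (1 + 1 / 2)) / 1 := (log_sandwich_sum_inv_affine (by norm_num) one_pos K).2
    _ = Real.log K + Real.log (3 / 2) := by norm_num

end Run

/-- **At the START of a level, `D(16^{m+1}) ≤ 1/7`:** the active scales below `16^{m+1}` lie below `2·16^m`, each
contributing at most `1/(2 + 16^{m+1} − j) ≤ 1/(14·16^m)`. -/
theorem D_start_le {s : ℕ → ℝ} {m : ℕ} (h362 : Recursion362 dip2 s (16 ^ (m + 1))) (hK : s (16 ^ (m + 1)) = 1)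
    (hs : ∀ n, n ≤ 16 ^ (m + 1) → 0 < s n ∧ s n ≤ 1) :
    ∑ j ∈ Finset.range (16 ^ (m + 1)), delta j * s j ≤ 1 / 7 := by
  have hle : 2 * 16 ^ m ≤ 16 ^ (m + 1) := by rw [pow_succ]; omega
  rw [← Finset.sum_range_add_sum_Ico _ hle]
  have hzero : ∑ j ∈ Finset.Ico (2 * 16 ^ m) (16 ^ (m + 1)), delta j * s j = 0 := by
    refine Finset.sum_eq_zero fun j hj => ?_
    obtain ⟨hj1, hj2⟩ := Finset.mem_Ico.mp hj
    rw [delta_eq_zero_below hj2 hj1, zero_mul]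
  have hx : (0 : ℝ) < 16 ^ m := by positivity
  have hfirst : ∑ j ∈ Finset.range (2 * 16 ^ m), delta j * s j ≤
      ∑ j ∈ Finset.range (2 * 16 ^ m), 1 / (14 * (16 : ℝ) ^ m) := by
    refine Finset.sum_le_sum fun j hj => ?_
    have hj := Finset.mem_range.mp hj
    have hjK : j < 16 ^ (m + 1) := lt_of_lt_of_le hj hle
    refine (term_le h362 hK hs hjK).trans ?_
    apply one_div_le_one_div_of_le (by positivity)
    have : (j : ℝ) + 1 ≤ 2 * 16 ^ m := by exact_mod_cast hj
    push_cast
    rw [pow_succ]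
    linarith
  rw [hzero, add_zero]
  refine hfirst.trans ?_
  rw [Finset.sum_const, Finset.card_range, nsmul_eq_mul]
  push_cast
  rw [show (2 : ℝ) * 16 ^ m * (1 / (14 * 16 ^ m)) = 1 / 7 by field_simp; ring]

/-- The harmonic sum over the block `[N, 2N)` read backwards from `K = 2N`: `Σ_{j∈[N,2N)} 1/(1 + (2N − j)) ≥ log N − log 2`
(`…BareSums.log_sandwich_sum_inv_affine`). -/
theorem block_harmonic_ge (N : ℕ) :
    Real.log N - Real.log 2 ≤ ∑ j ∈ Finset.Ico N (2 * N), 1 / (1 + (((2 * N : ℕ) : ℝ) - j)) := by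
  have hre : ∑ j ∈ Finset.Ico N (2 * N), 1 / (1 + (((2 * N : ℕ) : ℝ) - j)) =
      ∑ i ∈ Finset.range N, 1 / (1 + 1 * ((N : ℝ) - i)) := by
    rw [Finset.sum_Ico_eq_sum_range, show 2 * N - N = N by omega]
    refine Finset.sum_congr rfl fun i _ => ?_
    push_cast
    ring
  rw [hre]
  have h := (log_sandwich_sum_inv_affine one_pos one_pos N).1
  rw [div_one, div_one, show (1 : ℝ) + 1 = 2 by norm_num] at h
  exact h

/-- `log 16^m = m·log 16` through the cast. -/
theorem log_cast_pow16 (m : ℕ) : Real.log (((16 ^ m : ℕ) : ℝ)) = (m : ℝ) * Real.log 16 := by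
  push_cast
  rw [Real.log_pow]

/-- **Right AFTER a block, `D(2·16^m) ≥ (m·log 16 − log 2)/(2√(m+1))`:** on the block the coefficient is the amplitude and
`g_j² ≥ 1/(1 + (2·16^m − j))`. -/
theorem le_D_block {s : ℕ → ℝ} {m : ℕ} (h362 : Recursion362 dip2 s (2 * 16 ^ m)) (hK : s (2 * 16 ^ m) = 1)
    (hs : ∀ n, n ≤ 2 * 16 ^ m → 0 < s n ∧ s n ≤ 1) :
    (2 * Real.sqrt ((m : ℝ) + 1))⁻¹ * ((m : ℝ) * Real.log 16 - Real.log 2) ≤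
      ∑ j ∈ Finset.range (2 * 16 ^ m), delta j * s j := by
  have hsub : Finset.Ico (16 ^ m) (2 * 16 ^ m) ⊆ Finset.range (2 * 16 ^ m) := fun j hj =>
    Finset.mem_range.mpr (Finset.mem_Ico.mp hj).2
  refine le_trans ?_ (Finset.sum_le_sum_of_subset_of_nonneg hsub
    fun j hj _ => (term_bounds hs (Finset.mem_range.mp hj).le).1)
  have hblock : ∀ j ∈ Finset.Ico (16 ^ m) (2 * 16 ^ m),
      (2 * Real.sqrt ((m : ℝ) + 1))⁻¹ * (1 / (1 + (((2 * 16 ^ m : ℕ) : ℝ) - j))) ≤ delta j * s j := by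
    intro j hj
    obtain ⟨hj1, hj2⟩ := Finset.mem_Ico.mp hj
    rw [delta_block hj1 hj2]
    refine mul_le_mul_of_nonneg_left ?_ (amp_pos_le m).1.le
    obtain ⟨hp, _⟩ := hs j hj2.le
    have hhi := (inv_bounds h362 hK hs hj2.le).2
    have hpos : 0 < 1 + (((2 * 16 ^ m : ℕ) : ℝ) - j) := by
      have : (j : ℝ) ≤ ((2 * 16 ^ m : ℕ) : ℝ) := by exact_mod_cast hj2.le
      linarith
    exact (one_div_le hpos hp).mpr hhi
  refine le_trans ?_ (Finset.sum_le_sum hblock)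
  rw [← Finset.mul_sum]
  refine mul_le_mul_of_nonneg_left ?_ (amp_pos_le m).1.le
  have h := block_harmonic_ge (16 ^ m)
  rwa [log_cast_pow16 m] at h

end

end Summit.QuantumFields.BalabanUV.Beta.EriceFlowEnclosureBareTwoLoopRate
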